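import Summits.Ventures.CertifiedManyBodySolver.Theorems.R2cBoxSpinConsumer
import Summits.Ventures.CertifiedManyBodySolver.Theorems.R2cAssembly

/-!
# Route `R2cOpenStripTangentLine` — closure lemmas for the cruxes `RightFamilyBelowLine` (stmt-Ventures-19262)
and `LeftFamilyBelowLine` (stmt-Ventures-19263)

HONEST FRAMING: first certified bounds; not a superconductivity verdict; every number certified or labelled float.
NO NUMBER IS CLAIMED HERE: every theorem of this file is an implication whose hypothesis is the sentence a
producer's certificate would assert (all of them `proof.conditional` by design, like the `Certificates` modules).

The two cruxes are `∃`-statements over certified all-`k` families of OPEN `a × (k·b)` clusters of the `t–t′`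
Hubbard model at `(t, t′, U) = (1, 0, 8)` whose `k`-free endpoint `(E+Δ)/(ab)` lies below the route's tangent line
`ℓ(n) = -18/25 + (8/5)(n − 7/8)` at the family's own filling `n = N/(ab)` (right window `[7/8, 1]`, left window
`[3/4, 7/8]`). This file turns each of the three certificate CONVENTIONS the programme uses into a one-line
closure of the cruxes (and of the rung leaf `MbsolverRungLeaves.M3Upper_tp0_le_m18o25` through the landed
assembly `Theorems.r2cAssembly_proof`):

* § 1 FORMAT-dbt convention — an all-`k` claim node (the shape of `Certificates.cert_dbt299pair_allk`): general
  windows, the filling-`7/8` case closing BOTH cruxes at once, and the two named geometries `8 × 32k` at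
  `N = 224k` (width-8 open strip, K8GATE family) and `32 × 4k` at `N = 112k` (lineage 1, the #354 geometry).
* § 2 ROW convention — ONE open-box ground-energy node `groundEnergy (hubbardOpenBoxTT' a b 1 0 8) N ≤ E`
  (the shape of the box rows #299 / #446 / #450): undressed stacking (`Δ = 0`) by the tree's open-in-open lemma
  `groundEnergy_hubbardOpenBoxTT'_le_mul_openBox` [Ruelle1969 §3.3]; the bare `8 × 32`, `N = 224` instance needs
  `E ≤ -4608/25 = -184.32`.
* § 3 φ-LEVEL convention — a Jordan–Wigner spin-side certificate sentence for one box, consumed by the landed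
  route item `BoxSpinConsumer` (`Theorems.boxSpinConsumer_proof`, p443672).
* § 4 the leaf, end to end, from each convention at filling `7/8`.
* § 5 negative knowledge by value: the landed #354 numbers and the RS forecast endpoint do NOT meet the bar.

Adapted from the route pen's sketch `DbtNodeClosureTemplate.lean` (sr-mbsolver-var-7 g12, evidence on both items,
sha16 19a1b17797f89af6) with the `PenSketch` predicates inlined as hypotheses (no new definitions).
-/

noncomputable section

open Matrix
open scoped BigOperators

namespace Summit.Ventures.CertifiedManyBodySolver.Theorems

open Literature.MathematicalPhysics.QuantumLattice
open Summit.Ventures.CertifiedManyBodySolver.Theses.R2cOpenStripTangentLine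

/-! ## § 0 Arithmetic of the filling-`7/8` case -/

/-- At filling exactly `7/8` (`8N = 7ab`, `a, b ≥ 1`) the density `N/(ab)` is `7/8`, it lies in BOTH windows, and the
tangent line takes the value `-18/25` there. [folklore] -/
theorem sevenEighths_window (a b N : ℕ) (ha : 1 ≤ a) (hb : 1 ≤ b) (hN : 8 * N = 7 * (a * b)) :
    (N : ℚ) / ((a : ℚ) * (b : ℚ)) = 7 / 8 ∧
    (7 / 8 : ℚ) * ((a : ℚ) * (b : ℚ)) ≤ (N : ℚ) ∧ (N : ℚ) ≤ (a : ℚ) * (b : ℚ) ∧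
    (3 / 4 : ℚ) * ((a : ℚ) * (b : ℚ)) ≤ (N : ℚ) ∧ (N : ℚ) ≤ (7 / 8 : ℚ) * ((a : ℚ) * (b : ℚ)) := by
  have ha' : (0 : ℚ) < a := by exact_mod_cast ha
  have hb' : (0 : ℚ) < b := by exact_mod_cast hb
  have hab : (0 : ℚ) < (a : ℚ) * (b : ℚ) := mul_pos ha' hb'
  have hNq : (8 : ℚ) * (N : ℚ) = 7 * ((a : ℚ) * (b : ℚ)) := by exact_mod_cast hN
  refine ⟨?_, by linarith, by linarith, by linarith, by linarith⟩
  rw [div_eq_iff hab.ne']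
  linarith

/-! ## § 1 FORMAT-dbt convention: an all-`k` claim node closes the cruxes -/

/-- **Both cruxes from ONE all-`k` family at filling `7/8`.** Any geometry `a × (k·b)`, `8N = 7ab`, with an all-`k`
node `E_open(a × k·b; k·N) ≤ k·E + (k−1)·Δ` and endpoint `(E+Δ)/(ab) ≤ -18/25` witnesses `RightFamilyBelowLine`
AND `LeftFamilyBelowLine` (the filling `7/8` is the common endpoint of the two windows, where `ℓ(7/8) = -18/25`).
[folklore] -/
theorem bothFamiliesBelowLine_of_allk_sevenEighths (a b N : ℕ) (E Δ : ℚ) (ha : 1 ≤ a) (hb : 1 ≤ b)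
    (hN : 8 * N = 7 * (a * b)) (hbar : (E + Δ) / ((a : ℚ) * (b : ℚ)) ≤ -18 / 25)
    (h : ∀ k : ℕ, 1 ≤ k → groundEnergy (hubbardOpenBoxTT' a (k * b) 1 0 8) (k * N) ≤
      ((((k : ℚ) * E + ((k : ℚ) - 1) * Δ) : ℚ) : ℝ)) :
    RightFamilyBelowLine ∧ LeftFamilyBelowLine := by
  obtain ⟨hn, hlo₁, hhi₁, hlo₂, hhi₂⟩ := sevenEighths_window a b N ha hb hN
  have hline : (E + Δ) / ((a : ℚ) * (b : ℚ)) ≤ -18 / 25 + 8 / 5 * ((N : ℚ) / ((a : ℚ) * (b : ℚ)) - 7 / 8) := by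
    rw [hn]; norm_num at hbar ⊢; exact hbar
  exact ⟨⟨a, b, N, E, Δ, ha, hb, hlo₁, hhi₁, hline, h⟩, ⟨a, b, N, E, Δ, ha, hb, hlo₂, hhi₂, hline, h⟩⟩

/-- **Width-8 open strip, FORMAT-dbt geometry (K8GATE family).** An all-`k` node for the OPEN `8 × 32k` clusters at
`N = 224k` (filling `7/8`) with endpoint `(E+Δ)/256 ≤ -18/25` closes both cruxes. [folklore] -/
theorem bothFamiliesBelowLine_of_allk_8x32k (E Δ : ℚ) (hbar : (E + Δ) / 256 ≤ -18 / 25)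
    (h : ∀ k : ℕ, 1 ≤ k → groundEnergy (hubbardOpenBoxTT' 8 (k * 32) 1 0 8) (k * 224) ≤
      ((((k : ℚ) * E + ((k : ℚ) - 1) * Δ) : ℚ) : ℝ)) :
    RightFamilyBelowLine ∧ LeftFamilyBelowLine :=
  bothFamiliesBelowLine_of_allk_sevenEighths 8 32 224 E Δ (by norm_num) (by norm_num) (by norm_num)
    (by norm_num at hbar ⊢; exact hbar) h

/-- **Lineage-1 geometry (the #354 shape).** An all-`k` node for the OPEN `32 × 4k` clusters at `N = 112k` (filling `7/8`)
with endpoint `(E+Δ)/128 ≤ -18/25` closes both cruxes. [folklore] -/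
theorem bothFamiliesBelowLine_of_allk_32x4k (E Δ : ℚ) (hbar : (E + Δ) / 128 ≤ -18 / 25)
    (h : ∀ k : ℕ, 1 ≤ k → groundEnergy (hubbardOpenBoxTT' 32 (k * 4) 1 0 8) (k * 112) ≤
      ((((k : ℚ) * E + ((k : ℚ) - 1) * Δ) : ℚ) : ℝ)) :
    RightFamilyBelowLine ∧ LeftFamilyBelowLine :=
  bothFamiliesBelowLine_of_allk_sevenEighths 32 4 112 E Δ (by norm_num) (by norm_num) (by norm_num)
    (by norm_num at hbar ⊢; exact hbar) h

/-- **Width-6 open strip, FORMAT-dbt geometry.** An all-`k` node for the OPEN `6 × 32k` clusters at `N = 168k` (filling `7/8`)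
with endpoint `(E+Δ)/192 ≤ -18/25` closes both cruxes (the cheaper-`D` sibling of the width-8 family). [folklore] -/
theorem bothFamiliesBelowLine_of_allk_6x32k (E Δ : ℚ) (hbar : (E + Δ) / 192 ≤ -18 / 25)
    (h : ∀ k : ℕ, 1 ≤ k → groundEnergy (hubbardOpenBoxTT' 6 (k * 32) 1 0 8) (k * 168) ≤
      ((((k : ℚ) * E + ((k : ℚ) - 1) * Δ) : ℚ) : ℝ)) :
    RightFamilyBelowLine ∧ LeftFamilyBelowLine :=
  bothFamiliesBelowLine_of_allk_sevenEighths 6 32 168 E Δ (by norm_num) (by norm_num) (by norm_num)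
    (by norm_num at hbar ⊢; exact hbar) h

/-! ## § 2 ROW convention: one open-box ground-energy node, undressed stacking (`Δ = 0`) -/

/-- **Undressed all-`k` family from one box node.** `E_open(a × b; N) ≤ E` (`N ≤ 2ab`) gives
`E_open(a × k·b; k·N) ≤ k·E = k·E + (k−1)·0` for every `k ≥ 1` — open-in-open stacking with `Kx = 1`, `Ky = k`
(`groundEnergy_hubbardOpenBoxTT'_le_mul_openBox`). [cite: Ruelle1969, §3.3] -/
theorem allk_of_groundEnergy_openBox_le {a b N : ℕ} {E : ℚ} (hN : N ≤ 2 * (a * b))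
    (h : groundEnergy (hubbardOpenBoxTT' a b 1 0 8) N ≤ ((E : ℚ) : ℝ)) :
    ∀ k : ℕ, 1 ≤ k → groundEnergy (hubbardOpenBoxTT' a (k * b) 1 0 8) (k * N) ≤
      ((((k : ℚ) * E + ((k : ℚ) - 1) * 0) : ℚ) : ℝ) := by
  intro k _hk
  have hst := groundEnergy_hubbardOpenBoxTT'_le_mul_openBox a b 1 k (1 : ℝ) 0 8 hN
  rw [Nat.one_mul] at hst
  have hst' : groundEnergy (hubbardOpenBoxTT' a (k * b) 1 0 8) (k * N) ≤
      (k : ℝ) * groundEnergy (hubbardOpenBoxTT' a b 1 0 8) N := by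
    simpa [Nat.one_mul, one_mul] using hst
  have hk0 : (0 : ℝ) ≤ (k : ℝ) := by positivity
  calc groundEnergy (hubbardOpenBoxTT' a (k * b) 1 0 8) (k * N)
      ≤ (k : ℝ) * groundEnergy (hubbardOpenBoxTT' a b 1 0 8) N := hst'
    _ ≤ (k : ℝ) * ((E : ℚ) : ℝ) := mul_le_mul_of_nonneg_left h hk0
    _ = ((((k : ℚ) * E + ((k : ℚ) - 1) * 0) : ℚ) : ℝ) := by push_cast; ring

/-- **Rank-2 crux from ONE box node** (right window): any open `a × b` box, `7/8 ≤ N/(ab) ≤ 1`, `E/(ab)` below the tangent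
line, `E_open(a × b; N) ≤ E` ⇒ `RightFamilyBelowLine` with `Δ = 0`. [cite: Ruelle1969, §3.3] -/
theorem rightFamilyBelowLine_of_groundEnergy_openBox_le (a b N : ℕ) (E : ℚ) (ha : 1 ≤ a) (hb : 1 ≤ b)
    (hlo : (7 / 8 : ℚ) * ((a : ℚ) * (b : ℚ)) ≤ (N : ℚ)) (hhi : (N : ℚ) ≤ (a : ℚ) * (b : ℚ))
    (hbar : E / ((a : ℚ) * (b : ℚ)) ≤ -18 / 25 + 8 / 5 * ((N : ℚ) / ((a : ℚ) * (b : ℚ)) - 7 / 8))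
    (h : groundEnergy (hubbardOpenBoxTT' a b 1 0 8) N ≤ ((E : ℚ) : ℝ)) : RightFamilyBelowLine := by
  have hab : (0 : ℚ) ≤ (a : ℚ) * (b : ℚ) := by positivity
  have hN : N ≤ 2 * (a * b) := by
    have : (N : ℚ) ≤ 2 * ((a : ℚ) * (b : ℚ)) := by linarith
    exact_mod_cast this
  exact ⟨a, b, N, E, 0, ha, hb, hlo, hhi, by simpa using hbar, allk_of_groundEnergy_openBox_le hN h⟩

/-- **Rank-3 crux from ONE box node** (left window `3/4 ≤ N/(ab) ≤ 7/8`). [cite: Ruelle1969, §3.3] -/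
theorem leftFamilyBelowLine_of_groundEnergy_openBox_le (a b N : ℕ) (E : ℚ) (ha : 1 ≤ a) (hb : 1 ≤ b)
    (hlo : (3 / 4 : ℚ) * ((a : ℚ) * (b : ℚ)) ≤ (N : ℚ)) (hhi : (N : ℚ) ≤ (7 / 8 : ℚ) * ((a : ℚ) * (b : ℚ)))
    (hbar : E / ((a : ℚ) * (b : ℚ)) ≤ -18 / 25 + 8 / 5 * ((N : ℚ) / ((a : ℚ) * (b : ℚ)) - 7 / 8))
    (h : groundEnergy (hubbardOpenBoxTT' a b 1 0 8) N ≤ ((E : ℚ) : ℝ)) : LeftFamilyBelowLine := by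
  have hab : (0 : ℚ) ≤ (a : ℚ) * (b : ℚ) := by positivity
  have hN : N ≤ 2 * (a * b) := by
    have : (N : ℚ) ≤ 2 * ((a : ℚ) * (b : ℚ)) := by linarith
    exact_mod_cast this
  exact ⟨a, b, N, E, 0, ha, hb, hlo, hhi, by simpa using hbar, allk_of_groundEnergy_openBox_le hN h⟩

/-- **Both cruxes from ONE box node at filling `7/8`** (`8N = 7ab`, `E/(ab) ≤ -18/25`). [cite: Ruelle1969, §3.3] -/
theorem bothFamiliesBelowLine_of_groundEnergy_openBox_le_sevenEighths (a b N : ℕ) (E : ℚ) (ha : 1 ≤ a)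
    (hb : 1 ≤ b) (hN : 8 * N = 7 * (a * b)) (hbar : E / ((a : ℚ) * (b : ℚ)) ≤ -18 / 25)
    (h : groundEnergy (hubbardOpenBoxTT' a b 1 0 8) N ≤ ((E : ℚ) : ℝ)) :
    RightFamilyBelowLine ∧ LeftFamilyBelowLine := by
  have hN2 : N ≤ 2 * (a * b) := by omega
  refine bothFamiliesBelowLine_of_allk_sevenEighths a b N E 0 ha hb hN (by simpa using hbar)
    (allk_of_groundEnergy_openBox_le hN2 h)

/-- **The bare K8GATE object.** ONE open `8 × 32` box at `N = 224` with `E_open ≤ E`, `E ≤ -4608/25 = -184.32 = -0.72·256`,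
closes both cruxes (undressed stacking). [cite: Ruelle1969, §3.3] -/
theorem bothFamiliesBelowLine_of_groundEnergy_8x32_le (E : ℚ) (hE : E ≤ -4608 / 25)
    (h : groundEnergy (hubbardOpenBoxTT' 8 32 1 0 8) 224 ≤ ((E : ℚ) : ℝ)) :
    RightFamilyBelowLine ∧ LeftFamilyBelowLine :=
  bothFamiliesBelowLine_of_groundEnergy_openBox_le_sevenEighths 8 32 224 E (by norm_num) (by norm_num)
    (by norm_num) (by norm_num; linarith) h

/-- **The bare width-6 object.** ONE open `6 × 32` box at `N = 168` with `E_open ≤ E ≤ -3456/25 = -138.24 = -0.72·192`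
closes both cruxes. [cite: Ruelle1969, §3.3] -/
theorem bothFamiliesBelowLine_of_groundEnergy_6x32_le (E : ℚ) (hE : E ≤ -3456 / 25)
    (h : groundEnergy (hubbardOpenBoxTT' 6 32 1 0 8) 168 ≤ ((E : ℚ) : ℝ)) :
    RightFamilyBelowLine ∧ LeftFamilyBelowLine :=
  bothFamiliesBelowLine_of_groundEnergy_openBox_le_sevenEighths 6 32 168 E (by norm_num) (by norm_num)
    (by norm_num) (by norm_num; linarith) h

/-! ## § 3 φ-LEVEL convention: a spin-side certificate sentence, through the landed `BoxSpinConsumer` -/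

/-- **Rank-2 crux from a spin-side certificate** (the registered stub shape `Sig.stub_spinCertRight`, unpacked): an explicit
Jordan–Wigner spin-side vector `φ` of ONE open `a × b` box supported on site-charge `N` (right window), nonzero, with
`Re⟨φ, toSpin(H_open) φ⟩ ≤ E·Re⟨φ, φ⟩` and `E/(ab)` below the tangent line ⇒ `RightFamilyBelowLine` (`Δ = 0`), by the landed
route item `BoxSpinConsumer`. [folklore] -/
theorem rightFamilyBelowLine_of_spin_cert (a b N : ℕ) (φ : TensorIndex (Fin a ×ₗ Fin b) 4 → ℂ) (E : ℚ)
    (ha : 1 ≤ a) (hb : 1 ≤ b)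
    (hlo : (7 / 8 : ℚ) * ((a : ℚ) * (b : ℚ)) ≤ (N : ℚ)) (hhi : (N : ℚ) ≤ (a : ℚ) * (b : ℚ))
    (hbar : E / ((a : ℚ) * (b : ℚ)) ≤ -18 / 25 + 8 / 5 * ((N : ℚ) / ((a : ℚ) * (b : ℚ)) - 7 / 8))
    (hch : ∀ k : TensorIndex (Fin a ×ₗ Fin b) 4, (∑ x, siteCharge (k x)) ≠ N → φ k = 0) (hne : φ ≠ 0)
    (hE : (star φ ⬝ᵥ (JordanWigner.toSpin (hubbardOpenBoxTT' a b 1 0 8) *ᵥ φ)).re ≤ (E : ℝ) * (star φ ⬝ᵥ φ).re) :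
    RightFamilyBelowLine := by
  have hNab : N ≤ a * b := by exact_mod_cast hhi
  refine ⟨a, b, N, E, 0, ha, hb, hlo, hhi, by simpa using hbar, fun k hk => ?_⟩
  simpa using boxSpinConsumer_proof a b N φ E ha hb hNab hch hne hE k hk

/-- **Rank-3 crux from a spin-side certificate** (left window; the shape `Sig.stub_spinCertLeft`, unpacked). [folklore] -/
theorem leftFamilyBelowLine_of_spin_cert (a b N : ℕ) (φ : TensorIndex (Fin a ×ₗ Fin b) 4 → ℂ) (E : ℚ)
    (ha : 1 ≤ a) (hb : 1 ≤ b)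
    (hlo : (3 / 4 : ℚ) * ((a : ℚ) * (b : ℚ)) ≤ (N : ℚ)) (hhi : (N : ℚ) ≤ (7 / 8 : ℚ) * ((a : ℚ) * (b : ℚ)))
    (hbar : E / ((a : ℚ) * (b : ℚ)) ≤ -18 / 25 + 8 / 5 * ((N : ℚ) / ((a : ℚ) * (b : ℚ)) - 7 / 8))
    (hch : ∀ k : TensorIndex (Fin a ×ₗ Fin b) 4, (∑ x, siteCharge (k x)) ≠ N → φ k = 0) (hne : φ ≠ 0)
    (hE : (star φ ⬝ᵥ (JordanWigner.toSpin (hubbardOpenBoxTT' a b 1 0 8) *ᵥ φ)).re ≤ (E : ℝ) * (star φ ⬝ᵥ φ).re) :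
    LeftFamilyBelowLine := by
  have hab : (0 : ℚ) ≤ (a : ℚ) * (b : ℚ) := by positivity
  have hNab : N ≤ a * b := by
    have : (N : ℚ) ≤ (a : ℚ) * (b : ℚ) := by linarith
    exact_mod_cast this
  refine ⟨a, b, N, E, 0, ha, hb, hlo, hhi, by simpa using hbar, fun k hk => ?_⟩
  simpa using boxSpinConsumer_proof a b N φ E ha hb hNab hch hne hE k hk

/-- **Both cruxes from a spin-side certificate at filling `7/8`** (`8N = 7ab`, `E/(ab) ≤ -18/25`). [folklore] -/
theorem bothFamiliesBelowLine_of_spin_cert_sevenEighths (a b N : ℕ) (φ : TensorIndex (Fin a ×ₗ Fin b) 4 → ℂ)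
    (E : ℚ) (ha : 1 ≤ a) (hb : 1 ≤ b) (hN : 8 * N = 7 * (a * b)) (hbar : E / ((a : ℚ) * (b : ℚ)) ≤ -18 / 25)
    (hch : ∀ k : TensorIndex (Fin a ×ₗ Fin b) 4, (∑ x, siteCharge (k x)) ≠ N → φ k = 0) (hne : φ ≠ 0)
    (hE : (star φ ⬝ᵥ (JordanWigner.toSpin (hubbardOpenBoxTT' a b 1 0 8) *ᵥ φ)).re ≤ (E : ℝ) * (star φ ⬝ᵥ φ).re) :
    RightFamilyBelowLine ∧ LeftFamilyBelowLine := by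
  obtain ⟨hn, hlo₁, hhi₁, hlo₂, hhi₂⟩ := sevenEighths_window a b N ha hb hN
  have hline : E / ((a : ℚ) * (b : ℚ)) ≤ -18 / 25 + 8 / 5 * ((N : ℚ) / ((a : ℚ) * (b : ℚ)) - 7 / 8) := by
    rw [hn]; norm_num at hbar ⊢; exact hbar
  exact ⟨rightFamilyBelowLine_of_spin_cert a b N φ E ha hb hlo₁ hhi₁ hline hch hne hE,
    leftFamilyBelowLine_of_spin_cert a b N φ E ha hb hlo₂ hhi₂ hline hch hne hE⟩

/-! ## § 4 The rung leaf, end to end (through the landed assembly `r2cAssembly_proof`) -/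

/-- The R2c leaf from the two cruxes (the assembly item by name). [folklore] -/
theorem m3Upper_tp0_le_m18o25_of_families (hR : RightFamilyBelowLine) (hL : LeftFamilyBelowLine) :
    Summit.Ventures.CertifiedManyBodySolver.MbsolverRungLeaves.M3Upper_tp0_le_m18o25 :=
  r2cAssembly_proof hR hL

/-- **Leaf from ONE all-`k` node at filling `7/8`** (any geometry, FORMAT-dbt convention). [folklore] -/
theorem m3Upper_tp0_le_m18o25_of_allk_sevenEighths (a b N : ℕ) (E Δ : ℚ) (ha : 1 ≤ a) (hb : 1 ≤ b)
    (hN : 8 * N = 7 * (a * b)) (hbar : (E + Δ) / ((a : ℚ) * (b : ℚ)) ≤ -18 / 25)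
    (h : ∀ k : ℕ, 1 ≤ k → groundEnergy (hubbardOpenBoxTT' a (k * b) 1 0 8) (k * N) ≤
      ((((k : ℚ) * E + ((k : ℚ) - 1) * Δ) : ℚ) : ℝ)) :
    Summit.Ventures.CertifiedManyBodySolver.MbsolverRungLeaves.M3Upper_tp0_le_m18o25 := by
  obtain ⟨hR, hL⟩ := bothFamiliesBelowLine_of_allk_sevenEighths a b N E Δ ha hb hN hbar h
  exact r2cAssembly_proof hR hL

/-- **Leaf from ONE open-box node at filling `7/8`** (ROW convention, undressed). [cite: Ruelle1969, §3.3] -/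
theorem m3Upper_tp0_le_m18o25_of_groundEnergy_openBox_le_sevenEighths (a b N : ℕ) (E : ℚ) (ha : 1 ≤ a)
    (hb : 1 ≤ b) (hN : 8 * N = 7 * (a * b)) (hbar : E / ((a : ℚ) * (b : ℚ)) ≤ -18 / 25)
    (h : groundEnergy (hubbardOpenBoxTT' a b 1 0 8) N ≤ ((E : ℚ) : ℝ)) :
    Summit.Ventures.CertifiedManyBodySolver.MbsolverRungLeaves.M3Upper_tp0_le_m18o25 := by
  obtain ⟨hR, hL⟩ := bothFamiliesBelowLine_of_groundEnergy_openBox_le_sevenEighths a b N E ha hb hN hbar h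
  exact r2cAssembly_proof hR hL

/-- **Leaf from a spin-side certificate at filling `7/8`** (φ-LEVEL convention). [folklore] -/
theorem m3Upper_tp0_le_m18o25_of_spin_cert_sevenEighths (a b N : ℕ) (φ : TensorIndex (Fin a ×ₗ Fin b) 4 → ℂ)
    (E : ℚ) (ha : 1 ≤ a) (hb : 1 ≤ b) (hN : 8 * N = 7 * (a * b)) (hbar : E / ((a : ℚ) * (b : ℚ)) ≤ -18 / 25)
    (hch : ∀ k : TensorIndex (Fin a ×ₗ Fin b) 4, (∑ x, siteCharge (k x)) ≠ N → φ k = 0) (hne : φ ≠ 0)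
    (hE : (star φ ⬝ᵥ (JordanWigner.toSpin (hubbardOpenBoxTT' a b 1 0 8) *ᵥ φ)).re ≤ (E : ℝ) * (star φ ⬝ᵥ φ).re) :
    Summit.Ventures.CertifiedManyBodySolver.MbsolverRungLeaves.M3Upper_tp0_le_m18o25 := by
  obtain ⟨hR, hL⟩ := bothFamiliesBelowLine_of_spin_cert_sevenEighths a b N φ E ha hb hN hbar hch hne hE
  exact r2cAssembly_proof hR hL

/-! ## § 5 Negative knowledge by value (no open-box energy is asserted; pure arithmetic on the programme's numbers) -/

/-- The landed #354 node numbers (`E_box = -96643377681791/2⁴⁰`, `Δ_upper = -677213940875/2³⁸`, geometry `32 × 4k`) do NOT meet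
the bar: `(E+Δ)/128 = -0.70594… > -18/25`; nor does the RS forecast endpoint `-12525490015723/2⁴⁴ = -0.71199…` (the leaf
`M3Upper_tp0_le_RS`); the missing amounts are `0.0140599…` and `0.0080083…` per site. [folklore] -/
theorem dbt299pair_and_RS_endpoints_above_bar :
    ¬ (((-96643377681791 / 1099511627776 : ℚ) + (-677213940875 / 274877906944)) / 128 ≤ -18 / 25) ∧
    ¬ ((-12525490015723 / 17592186044416 : ℚ) ≤ -18 / 25) ∧
    (-18 / 25 : ℚ) < -99352233445291 / 140737488355328 ∧
    (-99352233445291 / 140737488355328 : ℚ) - (-18 / 25) < 141 / 10000 ∧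
    (-12525490015723 / 17592186044416 : ℚ) - (-18 / 25) < 81 / 10000 := by
  refine ⟨by norm_num, by norm_num, by norm_num, by norm_num, by norm_num⟩

end Summit.Ventures.CertifiedManyBodySolver.Theorems

end
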